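import Literature.Topology.FourManifolds.K2LiteBandGen
import HarnessLib

/-!
# The band-coordinate K₂ track with a free approach width

Topic `Literature/Topology/FourManifolds`; fact seat `provefact-IsStrictHandleSlide.isSurgery`
(R. C. Kirby, *The Topology of 4-Manifolds*, LNM 1374 (1989), Ch. I §4, Fig. 4.2; remaining content:
the named fact (S) `Literature.Topology.FourManifolds.FramedLink.IsStrictHandleSlide.slideModel`).
`K2LiteBand.lean` / `K2LiteBandGen.lean` hardwire the width of the final approach step
`hr1 - hr0 = 1/100`. During the approach the slice angle of the route varies by `(hr1 - hr0) · |Θ'|`,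
which must stay small against the tip angle (`RouteMonotone.lean` needs the route angle in
`(0, π)`), so the width has to be a parameter: here `hr1 = fLo (tlo - 3ε/2) + 3/20 - μ`,
`hr0 = hr1 - μ`, `0 < μ ≤ 1/100` (`BandCore.liteHr1μ`), the speed bound `liteVmin2 μ` and slope
`liteMs2 μ` re-derived for these levels (same compactness argument), the track data
`BandCore.k2liteGen2` and its reshaping isotopy `BandCore.exists_ambientIsotopy_k2liteGen2`.

## References

* R. C. Kirby, *The Topology of 4-Manifolds*, LNM 1374, Springer (1989), Ch. I §4. [Kirby1989]
-/

open scoped Manifold ContDiff Topology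
open Set Real Filter Function

noncomputable section

namespace Literature.Topology.FourManifolds

namespace BandCore

variable {A B : Knot} {avoid : Set (Metric.sphere (0 : EuclideanSpace ℝ (Fin 4)) 1)} (c : BandCore A B avoid)

/-- The upper level of the approach step of width `μ`: `fLo (tlo - 3ε/2) + 3/20 - μ`. [folklore] -/
def liteHr1μ (μ : ℝ) : ℝ := c.fLo (c.tlo - c.epsLo - c.epsLo / 2) + 3 / 20 - μ

/-- `liteHrμ_lt` (auxiliary). [folklore] -/
theorem liteHrμ_lt {μ : ℝ} (hμ : 0 < μ) : c.liteHr1μ μ - μ < c.liteHr1μ μ := by linarith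

/-- **A positive lower bound of the abscissa speed on the landing levels** `Sr ∈ [1/8, 7/8]`. [folklore] -/
theorem exists_liteVmin2 {μ : ℝ} (hμ : 0 < μ) : ∃ v : ℝ, 0 < v ∧ ∀ t ∈ Icc (c.tlo - c.epsLo - c.epsLo) (c.tlo - c.epsLo - c.epsLo / 2),
    smoothStep (c.liteHr1μ μ - μ) (c.liteHr1μ μ) (c.liteHh t) ∈ Icc (8⁻¹ : ℝ) (7 / 8) →
    v ≤ deriv (smoothStep (c.liteHr1μ μ - μ) (c.liteHr1μ μ)) (c.liteHh t) * deriv c.fLo t := by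
  have hε := c.epsLo_pos'
  have hm := c.marks_lt
  set F : ℝ → ℝ := fun t ↦ deriv (smoothStep (c.liteHr1μ μ - μ) (c.liteHr1μ μ)) (c.liteHh t) * deriv c.fLo t with hF
  have hFc : Continuous F :=
    (((contDiff_smoothStep _ _).continuous_deriv (by simp)).comp c.continuous_liteHh).mul
      (c.fLo_spec.1.continuous_deriv (by simp))
  set Z : Set ℝ := {t ∈ Icc (c.tlo - c.epsLo - c.epsLo) (c.tlo - c.epsLo - c.epsLo / 2) |
    smoothStep (c.liteHr1μ μ - μ) (c.liteHr1μ μ) (c.liteHh t) ∈ Icc (8⁻¹ : ℝ) (7 / 8)} with hZ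
  have hZc : IsCompact Z := by
    refine isCompact_Icc.inter_right ?_
    exact isClosed_Icc.preimage ((continuous_smoothStep _ _).comp c.continuous_liteHh)
  -- `F > 0` on `Z`
  have hFpos : ∀ t ∈ Z, 0 < F t := by
    rintro t ⟨ht, hS⟩
    have hf : 0 < deriv c.fLo t := c.fLo_spec.2.2.1 t (by linarith [ht.2])
    have hin : c.liteHh t ∈ Ioo (c.liteHr1μ μ - μ) (c.liteHr1μ μ) := by
      constructor
      · by_contra h; rw [smoothStep_of_le (c.liteHrμ_lt hμ) (le_of_not_gt h)] at hS; norm_num at hS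
      · by_contra h; rw [smoothStep_of_ge (c.liteHrμ_lt hμ) (le_of_not_gt h)] at hS; norm_num at hS
    exact mul_pos (deriv_smoothStep_pos (c.liteHrμ_lt hμ) hin) hf
  by_cases hne : Z.Nonempty
  · obtain ⟨t₀, ht₀, hmin⟩ := hZc.exists_isMinOn hne hFc.continuousOn
    exact ⟨F t₀, hFpos t₀ ht₀, fun t ht hS ↦ hmin ⟨ht, hS⟩⟩
  · refine ⟨1, one_pos, fun t ht hS ↦ ?_⟩
    exact absurd ⟨t, ht, hS⟩ hne

/-- `liteVmin2` (auxiliary). [folklore] -/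
def liteVmin2 {μ : ℝ} (hμ : 0 < μ) : ℝ := Classical.choose (c.exists_liteVmin2 hμ)

/-- `liteVmin2_spec` (auxiliary). [folklore] -/
theorem liteVmin2_spec {μ : ℝ} (hμ : 0 < μ) : 0 < c.liteVmin2 hμ ∧ ∀ t ∈ Icc (c.tlo - c.epsLo - c.epsLo) (c.tlo - c.epsLo - c.epsLo / 2),
    smoothStep (c.liteHr1μ μ - μ) (c.liteHr1μ μ) (c.liteHh t) ∈ Icc (8⁻¹ : ℝ) (7 / 8) →
    c.liteVmin2 hμ ≤ deriv (smoothStep (c.liteHr1μ μ - μ) (c.liteHr1μ μ)) (c.liteHh t) * deriv c.fLo t :=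
  Classical.choose_spec (c.exists_liteVmin2 hμ)

/-- `m_s = 2 M_H / v_min` for the width `μ`. [folklore] -/
def liteMs2 {μ : ℝ} (hμ : 0 < μ) : ℝ := 2 * c.liteMH / c.liteVmin2 hμ

/-- `liteMs2_pos` (auxiliary). [folklore] -/
theorem liteMs2_pos {μ : ℝ} (hμ : 0 < μ) : 0 < c.liteMs2 hμ := div_pos (by linarith [c.liteMH_pos]) (c.liteVmin2_spec hμ).1

/-- `liteMs2_mul` (auxiliary). [folklore] -/
theorem liteMs2_mul {μ : ℝ} (hμ : 0 < μ) : c.liteMs2 hμ * c.liteVmin2 hμ = 2 * c.liteMH := by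
  rw [liteMs2]; field_simp [(c.liteVmin2_spec hμ).1.ne']

/-! ### The track data of the band core -/

/-- **The band-coordinate lower track of the band core with free approach width `μ` and descent
slope `m_s ≥ liteMs2 μ`**, tip depth `κ_D ≤ liteKmaxGen m_s`, landing width `εℓ`, bend width `u₁`. [cite: Kirby1989, Ch. I §4] -/
def k2liteGen2 {μ ms κD εℓ u₁ : ℝ} (hμ : 0 < μ) (hμ' : μ ≤ 100⁻¹) (hms : c.liteMs2 hμ ≤ ms) (hκ : 0 < κD) (hκ' : κD ≤ liteKmaxGen ms)
    (hε : 0 < εℓ) (hε' : 4 * εℓ ≤ κD) (hu : 0 < u₁) (hu' : u₁ ≤ κD) : K2LiteData where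
  a := c.alo + c.epsLo
  b := c.tlo - c.epsLo
  ε := c.epsLo
  f := c.fLo
  g := c.gLo
  ch := 3 / 20
  κ₀ := 2⁻¹
  hpl := (c.fLo (c.alo + c.epsLo) + c.fLo (c.tlo - c.epsLo - c.epsLo)) / 2
  hr0 := c.liteHr1μ μ - μ
  hr1 := c.liteHr1μ μ
  κD := κD
  εℓ := εℓ
  u₁ := u₁
  ms := ms
  vmin := c.liteVmin2 hμ
  MH := c.liteMH
  ε_pos := c.epsLo_pos'
  hab := by linarith [c.alo_add_lt_tlo_sub]
  f_smooth := c.fLo_spec.1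
  g_smooth := c.gLo_spec.1
  f_deriv_pos := fun t ht ↦ c.fLo_spec.2.2.1 t (by linarith [c.marks_lt.2.2.2.1, c.marks_lt.2.2.2.2.1, c.marks_lt.2.2.2.2.2.1])
  g_deriv_neg := fun t ht ↦ c.cLo_hyp.2.2.2 t (by linarith)
  ch_pos := by norm_num
  κ₀_pos := by norm_num
  κ₀_le := le_rfl
  hpl_gt := by
    have := c.fLo_lt_fLo (show c.alo + c.epsLo < c.tlo - c.epsLo - c.epsLo by linarith [c.alo_add_lt_tlo_sub, c.epsLo_pos'])
      (by linarith [c.epsLo_pos'])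
    linarith
  hpl_le := by
    have h1 := c.fLo_lt_fLo (show c.alo + c.epsLo < c.tlo - c.epsLo - c.epsLo by linarith [c.alo_add_lt_tlo_sub, c.epsLo_pos'])
      (by linarith [c.epsLo_pos'])
    have h2 := c.fLo_le_fLo (show c.tlo - c.epsLo - c.epsLo ≤ c.tlo - c.epsLo - c.epsLo / 2 by linarith [c.epsLo_pos'])
      (by linarith [c.epsLo_pos'])
    rw [liteHr1μ]; linarith
  hr0_gt := by
    have h2 := c.fLo_le_fLo (show c.tlo - c.epsLo - c.epsLo ≤ c.tlo - c.epsLo - c.epsLo / 2 by linarith [c.epsLo_pos'])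
      (by linarith [c.epsLo_pos'])
    rw [liteHr1μ]; linarith
  hr_lt := c.liteHrμ_lt hμ
  hr1_le := by rw [liteHr1μ]; linarith
  κD_pos := hκ
  κD_le := by linarith [hκ'.trans (liteKmaxGen_le ms)]
  κD_small := by linarith [hκ'.trans (liteKmaxGen_le ms)]
  εℓ_pos := hε
  εℓ_le := hε'
  u₁_pos := hu
  u₁_le := hu'
  ms_pos := (c.liteMs2_pos hμ).trans_le hms
  vmin_pos := (c.liteVmin2_spec hμ).1
  vmin_le := fun t ht hS ↦ (c.liteVmin2_spec hμ).2 t ht (by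
    have hk := hκ'.trans (liteKmaxGen_le ms)
    have e : c.liteHh t = c.fLo t + 3 / 20 * smoothStep (c.tlo - c.epsLo - c.epsLo) (c.tlo - c.epsLo - c.epsLo / 2) t := rfl
    rw [e]
    exact ⟨by linarith [hS.1], by linarith [hS.2]⟩)
  MH_ge := c.liteMH_spec
  ms_large := by
    have h := c.liteMs2_mul hμ
    nlinarith [mul_le_mul_of_nonneg_right hms (c.liteVmin2_spec hμ).1.le]
  f_lo := fun t ht ↦ by
    have := (c.fLo_mem_window (t := t) ⟨by linarith [ht.1, c.epsLo_pos'], by linarith [ht.2]⟩).1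
    linarith
  f_hi := fun t ht ↦ by
    have := (c.fLo_mem_window (t := t) ⟨by linarith [ht.1, c.epsLo_pos'], by linarith [ht.2]⟩).2
    linarith
  g_mem := fun t ht ↦ by
    have h := c.gLo_mem (t := t) (by linarith [ht.2, c.tlo_marksB.1])
    exact ⟨h.1, by linarith [h.2]⟩
  gap := fun t ht ↦ by
    have hg := c.gLo_le_landing ht.1
    have hf := (c.fLo_mem_window (t := c.tlo - c.epsLo - c.epsLo / 2)
      ⟨by linarith [c.alo_add_lt_tlo_sub, c.epsLo_pos'], by linarith [c.epsLo_pos']⟩).1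
    have hmsp : 0 < ms := (c.liteMs2_pos hμ).trans_le hms
    have hk : ms * κD ≤ 101⁻¹ := by
      have := hκ'.trans (liteKmaxGen_le' ms hmsp)
      rw [le_div_iff₀ hmsp] at this
      linarith
    rw [liteHr1μ]; linarith

section

variable {μ ms κD εℓ u₁ : ℝ} (hμ : 0 < μ) (hμ' : μ ≤ 100⁻¹) (hms : c.liteMs2 hμ ≤ ms) (hκ : 0 < κD) (hκ' : κD ≤ liteKmaxGen ms)
  (hε : 0 < εℓ) (hε' : 4 * εℓ ≤ κD) (hu : 0 < u₁) (hu' : u₁ ≤ κD)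

/-- The abscissa of the arch is the `smoothStep a b` of the track data. [folklore] -/
theorem cLo_fst_eq_gen2 (t : ℝ) :
    c.cLo t 0 = smoothStep (c.k2liteGen2 hμ hμ' hms hκ hκ' hε hε' hu hu').a (c.k2liteGen2 hμ hμ' hms hκ hκ' hε hε' hu hu').b t := by
  rw [c.cLo_apply_zero]; rfl

/-- The height of the arch is the `v` of the track data. [folklore] -/
theorem cLo_snd_eq_v_gen2 (t : ℝ) : c.cLo t 1 = (c.k2liteGen2 hμ hμ' hms hκ hκ' hε hε' hu hu').v t := by
  rw [c.cLo_apply_one, K2LiteData.v]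
  have e1 : (c.k2liteGen2 hμ hμ' hms hκ hκ' hε hε' hu hu').a + (c.k2liteGen2 hμ hμ' hms hκ hκ' hε hε' hu hu').ε = c.alo + 2 * c.epsLo := by
    show c.alo + c.epsLo + c.epsLo = _; ring
  have e2 : (c.k2liteGen2 hμ hμ' hms hκ hκ' hε hε' hu hu').b - (c.k2liteGen2 hμ hμ' hms hκ hκ' hε hε' hu hu').ε = c.tlo - 2 * c.epsLo := by
    show c.tlo - c.epsLo - c.epsLo = _; ring
  rw [e1, e2]; rfl

/-- **The reshaping isotopy of the lower arch along the band-coordinate track.** See the module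
docstring. [cite: Kirby1989, Ch. I §4] -/
theorem exists_ambientIsotopy_k2liteGen2 (hAB : Disjoint (range ⇑A) (range ⇑B))
    {O : Set (Metric.sphere (0 : EuclideanSpace ℝ (Fin 4)) 1)} (hO : IsOpen O)
    (hOsub : ∀ u ∈ Icc (0 : ℝ) 1, ∀ s ∈ Icc (c.alo + c.epsLo / 2) (c.tlo - c.epsLo / 4),
      c.band (pt2 ((1 - u) * c.cLo s 0 + u * (c.k2liteGen2 hμ hμ' hms hκ hκ' hε hε' hu hu').X₁ s)
        ((1 - u) * c.cLo s 1 + u * (c.k2liteGen2 hμ hμ' hms hκ hκ' hε hε' hu hu').H₁ s)) ∈ O) :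
    ∃ (Θ : AmbientIsotopy (𝓡 3) (Metric.sphere (0 : EuclideanSpace ℝ (Fin 4)) 1)) (k₂ : Knot),
      (∀ t y, y ∉ O → Θ.toFun t y = y) ∧ Θ.toFun 1 ∘ ⇑(c.rebuild hAB) = ⇑k₂ ∧
      (∀ s ∈ Icc (c.alo + c.epsLo / 2) (c.tlo - c.epsLo / 4),
        k₂ (circlePt s) = c.band (pt2 ((c.k2liteGen2 hμ hμ' hms hκ hκ' hε hε' hu hu').X₁ s) ((c.k2liteGen2 hμ hμ' hms hκ hκ' hε hε' hu hu').H₁ s))) ∧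
      (∀ t ∈ Ico c.alo (c.alo + 1), t ∉ Icc (c.alo + c.epsLo / 2) (c.tlo - c.epsLo / 4) →
        k₂ (circlePt t) = c.rebuild hAB (circlePt t)) := by
  set d := c.k2liteGen2 hμ hμ' hms hκ hκ' hε hε' hu hu' with hd
  have hε0 := c.epsLo_pos'
  have hab := c.alo_add_lt_tlo_sub
  have ha : d.a = c.alo + c.epsLo := rfl
  have hb : d.b = c.tlo - c.epsLo := rfl
  have hεd : d.ε = c.epsLo := rfl
  have hI : ∀ {s}, s ∈ Icc (c.alo + c.epsLo / 2) (c.tlo - c.epsLo / 4) →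
      s ∈ Icc (d.a - d.ε / 2) (d.b + 3 * d.ε / 4) := fun hs ↦ by
    rw [ha, hb, hεd]; exact ⟨by linarith [hs.1], by linarith [hs.2]⟩
  refine c.exists_ambientIsotopy_lowerTrack' hAB d.contDiff_X₁ d.contDiff_H₁ ?_ ?_ d.X₁_mem_Icc d.deriv_X₁_nonneg
    ?_ ?_ ?_ ?_ ?_ ?_ ?_ ?_ hO hOsub
  · -- hagreeX
    intro t ht
    rcases le_or_gt t (c.alo + c.epsLo) with h | h
    · rw [d.X₁_of_le_a (by rw [ha]; exact h), c.cLo_fst_eq_zero_of_le h]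
    · have h2 : c.tlo - c.epsLo / 2 ≤ t := by
        by_contra h2; exact ht ⟨h, lt_of_not_ge h2⟩
      rw [d.X₁_of_ge (by rw [hb, hεd]; linarith), c.cLo_fst_eq_one_of_ge (by linarith)]
  · -- hagreeH
    intro t ht
    rcases le_or_gt t (c.alo + c.epsLo) with h | h
    · rw [d.H₁_of_le_a (by rw [ha]; exact h), c.cLo_snd_eq_fLo_of_le (by linarith)]; rfl
    · have h2 : c.tlo - c.epsLo / 2 ≤ t := by
        by_contra h2; exact ht ⟨h, lt_of_not_ge h2⟩
      rw [d.H₁_of_ge (by rw [hb, hεd]; linarith), c.cLo_snd_eq_gLo_of_ge (by linarith)]; rfl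
  · -- hX₁zero
    intro s _ h0
    have := d.le_a_of_X₁_eq_zero h0
    rw [d.H₁_of_le_a this]; rfl
  · -- hX₁lt
    intro t ht
    exact d.X₁_lt_one_of_le (by rw [hb, hεd]; linarith)
  · -- hH₁I
    intro t ht
    exact d.H₁_mem_Ioo (hI ht)
  · -- hH₁ge
    intro t ht hX
    exact d.g_le_H₁ (by rw [hb, hεd]; exact ⟨by linarith [ht.1], by linarith [ht.2]⟩) hX
  · -- hinj₁
    intro s hs t ht h
    apply d.injOn_track (hI hs) (hI ht)
    have h0 : d.X₁ s = d.X₁ t := by simpa using congrArg (fun p : EuclideanSpace ℝ (Fin 2) ↦ p 0) h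
    have h1 : d.H₁ s = d.H₁ t := by simpa using congrArg (fun p : EuclideanSpace ℝ (Fin 2) ↦ p 1) h
    exact Prod.ext h0 h1
  · -- hreg₁
    intro s hs hX
    exact d.deriv_H₁_ne_zero (hI hs) hX
  · -- hco
    intro t ht t' ht' hlt h0 _
    rw [c.cLo_fst_eq_gen2 hμ hμ' hms hκ hκ' hε hε' hu hu', c.cLo_fst_eq_gen2 hμ hμ' hms hκ hκ' hε hε' hu hu'] at h0
    have := d.co_mono (hI ht) (hI ht') hlt h0
    rw [c.cLo_snd_eq_v_gen2 hμ hμ' hms hκ hκ' hε hε' hu hu', c.cLo_snd_eq_v_gen2 hμ hμ' hms hκ hκ' hε hε' hu hu']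
    exact this
  · -- hcoD
    intro s hs hχ' _
    have eχ : (fun t ↦ c.cLo t 0) = smoothStep d.a d.b := funext fun t ↦ c.cLo_fst_eq_gen2 hμ hμ' hms hκ hκ' hε hε' hu hu' t
    have ev : (fun t ↦ c.cLo t 1) = d.v := funext fun t ↦ c.cLo_snd_eq_v_gen2 hμ hμ' hms hκ hκ' hε hε' hu hu' t
    rw [eχ] at hχ'
    rw [ev]
    exact d.co_monoD (hI hs) hχ'

end

end BandCore

end Literature.Topology.FourManifolds
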